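import Summits.Ventures.WeilGRH.ZetaWindowAtoms
import Summits.Ventures.WeilGRH.ZetaWindowAtomsLimit
import Summits.Ventures.WeilGRH.ZetaGramAtoms
import Summits.Ventures.WeilGRH.WindowCertificateNeighbours
import Summits.RiemannHypothesis.RiemannHypothesis.Theorems.HandoffCramerBump
import HarnessLib

/-!
# rh-explicit (venture WeilGRH): under RH — the multiplicity of every zero of `ζ` from one window, and
  decided by one finite window

Cell `rh-explicit`, WEIL TRACK (structure seat weil-3, gen10).  The RH corollaries of `ZetaWindowAtoms.lean`
(one `ζ`-rung bounds the spectral mass at every height, budget in closed form) and `ZetaWindowAtomsLimit.lean`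
(the window forms of the modulated flat windows are complete multiplicity certificates), read on the
zero-height measure `ν_ζ = Σ_ρ m_ρ δ_{Im ρ}`, which represents Weil's form on every window under RH
(`WeilBochnerRepresentationRH`) and whose atoms are the multiplicities
(`ZetaGramAtoms.zetaZeroHeightMeasure_singleton_of_riemannHypothesis`):

* (the BUDGET forms — `2a·ord ≤` explicit prime/archimedean budget, Goldston–Gonek shape and constant — are
  `ZetaMultiplicityBound.lean`, which needs only `ZetaWindowAtoms`);
* `two_mul_mul_zetaZeroOrder_le_weilWindowForm`: RH ⟹ `2a · ord_{s=½+iτ} ζ ≤ weilWindowForm a (e^{−iτx}χ_0)`;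
* `measureReal_Icc_le_log` (RH-free!): every `ζ`-window measure of ONE rung is locally log-sparse,
  `μ[τ − π/(2a), τ + π/(2a)] ≤ (π²/8a)(pole + prime budget − K₀ + log(1+|τ|) + 3 − ψ(¼) + 5/a)`; `zetaZeroCount_Icc_le_log` (RH);
* `mul_zetaZeroCount_Icc_le_weilWindowForm`: RH ⟹ `(8a/π²)·#{ρ : |γ − τ| ≤ π/(2a)} (with multiplicity) ≤ W_a(e^{−iτx}χ_0)`;
* `weilWindowForm_modulated_sub_zetaZeroOrder_mem`: RH ⟹ `0 ≤ W_a(e^{−iτx}χ_0) − 2a·ord ≤ (2/a)Σ_{γ≠τ} m/(γ−τ)²`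
  (`integrable_inv_sq_sub_zetaZeroHeightMeasure`: that sum is finite, unconditionally) — rate `a⁻²`;
* `weilWindowForm_modulated_lt_of_riemannHypothesis`: RH ⟹ every window with `a² > Σ_{γ'≠τ} m'/(γ'−τ)²` is SHARP
  at `τ` (`W_a < 2a(ord+1)`) — the CERTIFICATE LENGTH is the root of the second inverse moment of the other zeros;
* **`tendsto_weilWindowForm_modulated_div_of_riemannHypothesis`**: RH ⟹
  `weilWindowForm a (e^{−iτx}χ_0)/(2a) → ord_{s=½+iτ} ζ(s)` (`a → ∞`);
* **`zetaZeroOrder_le_iff_of_riemannHypothesis`**: RH ⟹ `ord_{s=½+iτ} ζ ≤ k ↔ ∃ a > 0, W_a(e^{−iτx}χ_0) < 2a(k+1)`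
  — the multiplicity of every zero (its simplicity, `k = 1`; `ζ(½+iτ) ≠ 0`, `k = 0`) is DECIDED BY ONE
  FINITE WINDOW, whose form is explicit (pole + primes below `e^{2a}` + digamma weight).

No definitions, no named facts; RH is a hypothesis of every theorem here.

## References

* D. A. Goldston, S. M. Gonek, *A note on S(t) and the zeros of the Riemann zeta-function*, Bull. London
  Math. Soc. 39 (2007) 482–486. [GoldstonGonek2007]
* `two_mul_mul_zetaZeroOrder_add_one_le_of_two_zeros` (RH corollary of `WindowCertificateNeighbours`): if two
  distinct zero heights `γ₁, γ₂ ≠ τ` (`ord ≥ 1` at each) lie within `1/a` of `τ`, then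
  `2a·(ord_{s=½+iτ}ζ + 1) ≤ weilWindowForm a (e^{−iτx}χ_0)` — the rung-`a` window does NOT certify the
  multiplicity at `τ`: NO CERTIFICATE BELOW THE LOCAL SPACING (`1/d₂(τ) ≤ a*(τ)`; with
  `weilWindowForm_modulated_lt_of_riemannHypothesis`, `a*(τ) ≤ √M₂(τ)`: the certificate-length law is two-sided).
-/

set_option autoImplicit false

noncomputable section

open Complex Filter Set MeasureTheory
open scoped Real Topology ComplexConjugate ArithmeticFunction.vonMangoldt

namespace Summit.Ventures.WeilGRH

open Literature.NumberTheory.LFunctions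
open Literature.NumberTheory.LFunctions.Yoshida1992 (chi)
open Literature.NumberTheory.LFunctions.WeilBochner (zetaZeroHeightMeasure)
open Literature.Analysis.SpecialFunctions (reDigammaQuarter)

variable {a : ℝ}

/-- **RH ⟹ every window-form value bounds every multiplicity**: for `a > 0` and `τ ∈ ℝ`,
`2a · ord_{s=½+iτ} ζ(s) ≤ weilWindowForm a (e^{−iτx}χ_0)`. -/
theorem two_mul_mul_zetaZeroOrder_le_weilWindowForm (hRH : RiemannHypothesis) (ha : 0 < a) (τ : ℝ) :
    2 * a * ((riemannZetaZeroOrder (1 / 2 + τ * I)).toNat : ℝ) ≤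
      weilWindowForm a (fun x ↦ cexp (I * ((-τ) * x : ℝ)) * chi a 0 x) := by
  have h := two_mul_mul_atom_le_weilWindowForm ha
    (fun _ hg _ ↦ WeilBochner.weilQuadratic_eq_integral_of_riemannHypothesis hRH hg) τ
  rwa [measureReal_def, zetaZeroHeightMeasure_singleton_of_riemannHypothesis hRH, ENNReal.toReal_natCast] at h

/-- **RH ⟹ ONE WINDOW COUNTS THE ZEROS IN A SHORT INTERVAL**: for `a > 0` and `τ ∈ ℝ`, the number of zeros
`½ + iγ` with `|γ − τ| ≤ π/(2a)`, counted with multiplicity (`= ν_ζ[τ − π/(2a), τ + π/(2a)]`), satisfies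
`(8a/π²) · ν_ζ[τ − π/(2a), τ + π/(2a)] ≤ weilWindowForm a (e^{−iτx}χ_0)` — the positivity form of
`N(T+h) − N(T−h) ≪ log T/log log T` for `h ≍ 1/log log T`. -/
theorem mul_zetaZeroCount_Icc_le_weilWindowForm (hRH : RiemannHypothesis) (ha : 0 < a) (τ : ℝ) :
    8 * a / π ^ 2 * zetaZeroHeightMeasure.real (Icc (τ - π / (2 * a)) (τ + π / (2 * a))) ≤
      weilWindowForm a (fun x ↦ cexp (I * ((-τ) * x : ℝ)) * chi a 0 x) :=
  mul_measureReal_Icc_le_weilWindowForm ha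
    (fun _ hg _ ↦ WeilBochner.weilQuadratic_eq_integral_of_riemannHypothesis hRH hg) τ

/-! ## One rung makes every Weil measure locally log-sparse (RH-free), and counts zeros in short intervals (RH) -/

/-- **LOCAL LOG-DENSITY OF EVERY WEIL MEASURE FROM ONE RUNG** (RH-free).  For `a > 0`, every positive `μ`
representing Weil's form on the tests of `[-a, a]` (such `μ` exist unconditionally for `a ≤ 4023/5000`) and
every `τ ∈ ℝ`:

  `μ[τ − π/(2a), τ + π/(2a)] ≤ (π²/(8a)) · ( 4(sinh²(a/2) + sin²(aτ))/(a(¼+τ²)) − K₀ + [log(1+|τ|) + 3 − ψ(¼)] + 5/a`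
                                  `+ 2Σ_{log n<2a} Λ(n)n^{-1/2}(1 − log n/(2a)) )`

— the spectral measure of ONE rung has at most logarithmic local density in the height, with explicit
constants (`mul_measureReal_Icc_le_weilWindowForm` + `weilWindowForm_modulated_le_budget` + the digamma
majorant `Re ψ(¼+iτ/2) ≤ log(1+|τ|) + 3` of `HandoffCramerBump`). -/
theorem measureReal_Icc_le_log (ha : 0 < a) {μ : Measure ℝ}
    (hμ : ∀ g : ℝ → ℂ, IsWeilTest g → tsupport g ⊆ Icc (-a) a →
      Integrable (fun t : ℝ ↦ ‖weilMellin g (1 / 2 + t * I)‖ ^ 2) μ ∧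
        weilQuadratic g = ((∫ t, ‖weilMellin g (1 / 2 + t * I)‖ ^ 2 ∂μ : ℝ) : ℂ)) (τ : ℝ) :
    μ.real (Icc (τ - π / (2 * a)) (τ + π / (2 * a))) ≤
      π ^ 2 / (8 * a) *
        (4 * (Real.sinh (a / 2) ^ 2 + Real.sin (τ * a) ^ 2) / (a * (1 / 4 + τ ^ 2)) -
          (Real.log (4 * π) + Real.eulerMascheroniConstant +
            2 * ∫ t in Ioi (0 : ℝ), (Real.exp (t / 2) - 1) / (2 * Real.sinh t)) +
          (Real.log (1 + |τ|) + 3 - reDigammaQuarter 0) + 5 / a +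
          2 * (∑ n ∈ weilPrimeIndex a, (Λ n : ℝ) / Real.sqrt n * (1 - Real.log n / (2 * a)))) := by
  have h1 := mul_measureReal_Icc_le_weilWindowForm ha hμ τ
  have h2 := weilWindowForm_modulated_le_budget ha τ
  have h3 := Summit.RiemannHypothesis.RiemannHypothesis.Theorems.Handoff.reDigammaQuarter_le_log_add_three τ
  have hpos : 0 < 8 * a / π ^ 2 := by positivity
  have hπ : π ≠ 0 := Real.pi_ne_zero
  have ha' : a ≠ 0 := ha.ne'
  have h1' : μ.real (Icc (τ - π / (2 * a)) (τ + π / (2 * a))) ≤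
      π ^ 2 / (8 * a) * weilWindowForm a (fun x ↦ cexp (I * ((-τ) * x : ℝ)) * chi a 0 x) := by
    have h := (le_div_iff₀' hpos).2 h1
    calc _ ≤ _ := h
      _ = _ := by field_simp
  refine h1'.trans (mul_le_mul_of_nonneg_left ?_ (by positivity))
  linarith

/-- **RH ⟹ AN EXPLICIT ZERO COUNT IN SHORT INTERVALS FROM ONE WINDOW**: for every `a > 0` and `τ ∈ ℝ`, the
number of zeros `½+iγ` with `|γ − τ| ≤ π/(2a)`, counted with multiplicity, is at most
`(π²/(8a)) · ( 4(sinh²(a/2) + sin²(aτ))/(a(¼+τ²)) − K₀ + [log(1+|τ|) + 3 − ψ(¼)] + 5/a + 2Σ_{log n<2a}Λ(n)n^{-1/2}(1 − log n/(2a)) )`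
— `≍ (π²/8a)·log|τ|` for fixed `a`: the classical `N(T+h) − N(T−h) ≪ log T` with explicit constants, from
positivity at one window. -/
theorem zetaZeroCount_Icc_le_log (hRH : RiemannHypothesis) (ha : 0 < a) (τ : ℝ) :
    zetaZeroHeightMeasure.real (Icc (τ - π / (2 * a)) (τ + π / (2 * a))) ≤
      π ^ 2 / (8 * a) *
        (4 * (Real.sinh (a / 2) ^ 2 + Real.sin (τ * a) ^ 2) / (a * (1 / 4 + τ ^ 2)) -
          (Real.log (4 * π) + Real.eulerMascheroniConstant +
            2 * ∫ t in Ioi (0 : ℝ), (Real.exp (t / 2) - 1) / (2 * Real.sinh t)) +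
          (Real.log (1 + |τ|) + 3 - reDigammaQuarter 0) + 5 / a +
          2 * (∑ n ∈ weilPrimeIndex a, (Λ n : ℝ) / Real.sqrt n * (1 - Real.log n / (2 * a)))) :=
  measureReal_Icc_le_log ha (fun _ hg _ ↦ WeilBochner.weilQuadratic_eq_integral_of_riemannHypothesis hRH hg) τ

/-! ## Under RH the certificate converges at rate `a⁻²·Σ_{ρ≠} m_ρ/(γ−τ)²` -/

open Literature.NumberTheory.LFunctions.ZetaZeros (riemannZetaNontrivialZeros) in
/-- **`(t−τ)⁻² ∈ L¹(ν_ζ)` for every `τ`** (unconditional; the zero AT height `τ`, if any, is not counted —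
`0⁻¹ = 0`): off the finitely many zeros with `|Im ρ| ≤ 2|τ|+1` one has `(γ−τ)⁻² ≤ 4(1+γ²)⁻¹`, and
`Σ_ρ m(ρ)/(1+γ²) < ∞`. -/
theorem integrable_inv_sq_sub_zetaZeroHeightMeasure (τ : ℝ) :
    Integrable (fun t : ℝ ↦ ((t - τ) ^ 2)⁻¹) zetaZeroHeightMeasure := by
  have hmeas : Measurable fun t : ℝ ↦ ((t - τ) ^ 2)⁻¹ := ((measurable_id.sub_const τ).pow_const 2).inv
  refine integrable_zetaZeroHeightMeasure_of_summable hmeas (fun t ↦ by positivity) ?_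
  have hg : Summable fun ρ : riemannZetaNontrivialZeros ↦
      4 * ((riemannZetaZeroOrder (ρ : ℂ) : ℝ) / (1 + (ρ : ℂ).im ^ 2)) :=
    ZetaZeroSum.summable_zeroOrder_div_one_add_sq.mul_left 4
  refine Summable.of_norm_bounded_eventually hg ?_
  filter_upwards [(weilZeroFinset (2 * |τ| + 1)).eventually_cofinite_notMem] with ρ hρ
  rw [mem_weilZeroFinset, not_le] at hρ
  rw [toNat_riemannZetaZeroOrder_cast]
  have hm0 : (0 : ℝ) ≤ riemannZetaZeroOrder (ρ : ℂ) := by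
    exact_mod_cast riemannZetaZeroOrder_nonneg (ZetaZeros.riemannZetaNontrivialZeros.ne_one ρ.2)
  rw [Real.norm_of_nonneg (mul_nonneg hm0 (by positivity))]
  set γ : ℝ := (ρ : ℂ).im with hγ
  -- `|γ − τ| ≥ |γ| − |τ| > (|γ| + 1)/2`, so `(γ−τ)² ≥ (1+γ²)/4`
  have h1 : (|γ| + 1) / 2 ≤ |γ - τ| := by
    have := abs_sub_abs_le_abs_sub γ τ
    linarith
  have h1' : 0 ≤ (|γ| + 1) / 2 := by positivity
  have h2 : (1 + γ ^ 2) / 4 ≤ (γ - τ) ^ 2 := by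
    have h3 := pow_le_pow_left₀ h1' h1 2
    rw [sq_abs] at h3
    nlinarith [abs_nonneg γ, sq_abs γ]
  have h4 : ((γ - τ) ^ 2)⁻¹ ≤ 4 / (1 + γ ^ 2) := by
    rcases eq_or_ne ((γ - τ) ^ 2) 0 with h0 | h0
    · rw [h0, inv_zero]; positivity
    · rw [inv_eq_one_div, div_le_div_iff₀ (lt_of_le_of_ne (sq_nonneg _) (Ne.symm h0)) (by positivity)]
      linarith
  calc (riemannZetaZeroOrder (ρ : ℂ) : ℝ) * ((γ - τ) ^ 2)⁻¹
      ≤ (riemannZetaZeroOrder (ρ : ℂ) : ℝ) * (4 / (1 + γ ^ 2)) := mul_le_mul_of_nonneg_left h4 hm0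
    _ = 4 * ((riemannZetaZeroOrder (ρ : ℂ) : ℝ) / (1 + γ ^ 2)) := by ring

/-- **RH ⟹ QUANTITATIVE COMPLETENESS**: for every `a > 0` and `τ ∈ ℝ`,

  `0 ≤ weilWindowForm a (e^{−iτx}χ_0) − 2a·ord_{s=½+iτ}ζ(s) ≤ (2/a)·Σ_{ρ : γ ≠ τ} m_ρ/(γ−τ)²`

(the sum written as `∫((t−τ)²)⁻¹dν_ζ`): the one-window certificate overshoots the multiplicity by `O(a⁻²)`
after dividing by `2a`. -/
theorem weilWindowForm_modulated_sub_zetaZeroOrder_mem (hRH : RiemannHypothesis) (ha : 0 < a) (τ : ℝ) :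
    0 ≤ weilWindowForm a (fun x ↦ cexp (I * ((-τ) * x : ℝ)) * chi a 0 x) -
        2 * a * ((riemannZetaZeroOrder (1 / 2 + τ * I)).toNat : ℝ) ∧
      weilWindowForm a (fun x ↦ cexp (I * ((-τ) * x : ℝ)) * chi a 0 x) -
          2 * a * ((riemannZetaZeroOrder (1 / 2 + τ * I)).toNat : ℝ) ≤
        2 / a * ∫ t, ((t - τ) ^ 2)⁻¹ ∂zetaZeroHeightMeasure := by
  have hμ : ∀ g : ℝ → ℂ, IsWeilTest g → tsupport g ⊆ Icc (-a) a →
      Integrable (fun t : ℝ ↦ ‖weilMellin g (1 / 2 + t * I)‖ ^ 2) zetaZeroHeightMeasure ∧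
        weilQuadratic g = ((∫ t, ‖weilMellin g (1 / 2 + t * I)‖ ^ 2 ∂zetaZeroHeightMeasure : ℝ) : ℂ) :=
    fun _ hg _ ↦ WeilBochner.weilQuadratic_eq_integral_of_riemannHypothesis hRH hg
  have hlo := two_mul_mul_atom_le_weilWindowForm ha hμ τ
  have hhi := weilWindowForm_modulated_le_atom_add ha hμ τ (integrable_inv_sq_sub_zetaZeroHeightMeasure τ)
  rw [measureReal_def, zetaZeroHeightMeasure_singleton_of_riemannHypothesis hRH, ENNReal.toReal_natCast] at hlo hhi
  constructor <;> linarith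

/-- **RH ⟹ CERTIFICATE LENGTH**: if `a² > Σ_{ρ' : γ' ≠ τ} m_{ρ'}/(γ'−τ)²` then the window `a` is already SHARP
at height `τ`: `weilWindowForm a (e^{−iτx}χ_0) < 2a·(ord_{s=½+iτ}ζ + 1)`, i.e. it certifies `ord ≤ m` with the
true `m` (`zetaZeroOrder_le_iff_of_riemannHypothesis`, `←`).  The length of a sharp certificate is the root of
the second inverse moment of the OTHER zeros seen from `τ`. -/
theorem weilWindowForm_modulated_lt_of_riemannHypothesis (hRH : RiemannHypothesis) (ha : 0 < a) (τ : ℝ)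
    (hM : ∫ t, ((t - τ) ^ 2)⁻¹ ∂zetaZeroHeightMeasure < a ^ 2) :
    weilWindowForm a (fun x ↦ cexp (I * ((-τ) * x : ℝ)) * chi a 0 x) <
      2 * a * (((riemannZetaZeroOrder (1 / 2 + τ * I)).toNat : ℝ) + 1) := by
  have h := (weilWindowForm_modulated_sub_zetaZeroOrder_mem hRH ha τ).2
  have h2 : 2 / a * ∫ t, ((t - τ) ^ 2)⁻¹ ∂zetaZeroHeightMeasure < 2 / a * a ^ 2 :=
    mul_lt_mul_of_pos_left hM (by positivity)
  have h3 : 2 / a * a ^ 2 = 2 * a := by field_simp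
  linarith

/-- **RH ⟹ THE MULTIPLICITY OF EVERY ZERO IS THE LIMIT OF THE NORMALISED WINDOW FORMS**:
`weilWindowForm a (e^{−iτx}χ_0) / (2a) → ord_{s=½+iτ} ζ(s)` as `a → ∞`, for every `τ ∈ ℝ`. -/
theorem tendsto_weilWindowForm_modulated_div_of_riemannHypothesis (hRH : RiemannHypothesis) (τ : ℝ) :
    Tendsto (fun a : ℝ ↦ weilWindowForm a (fun x ↦ cexp (I * ((-τ) * x : ℝ)) * chi a 0 x) / (2 * a))
      atTop (𝓝 ((riemannZetaZeroOrder (1 / 2 + τ * I)).toNat : ℝ)) := by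
  have h := tendsto_weilWindowForm_modulated_div
    (fun g hg ↦ WeilBochner.weilQuadratic_eq_integral_of_riemannHypothesis hRH hg) τ
  rwa [measureReal_def, zetaZeroHeightMeasure_singleton_of_riemannHypothesis hRH, ENNReal.toReal_natCast] at h

/-- **RH ⟹ THE MULTIPLICITY OF EVERY ZERO IS DECIDED BY ONE FINITE WINDOW.**  For every `τ ∈ ℝ` and
`k ∈ ℕ`:  `ord_{s=½+iτ} ζ(s) ≤ k ↔ ∃ a > 0, weilWindowForm a (e^{−iτx}χ_0) < 2a(k+1)`.
In particular (`k = 1`) a zero `½+iγ` is SIMPLE iff some window has `W_a(e^{−iγx}χ_0) < 4a`, and (`k = 0`)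
`ζ(½+iτ) ≠ 0` iff some window has `W_a(e^{−iτx}χ_0) < 2a`: the window certificates (`←`, sound at every
`a`; closed form in `ZetaWindowAtoms.lean`) are COMPLETE (`→`). -/
theorem zetaZeroOrder_le_iff_of_riemannHypothesis (hRH : RiemannHypothesis) (τ : ℝ) (k : ℕ) :
    (riemannZetaZeroOrder (1 / 2 + τ * I)).toNat ≤ k ↔
      ∃ a : ℝ, 0 < a ∧ weilWindowForm a (fun x ↦ cexp (I * ((-τ) * x : ℝ)) * chi a 0 x) < 2 * a * (k + 1) := by
  set m : ℕ := (riemannZetaZeroOrder (1 / 2 + τ * I)).toNat with hm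
  constructor
  · intro hk
    have hlt : (m : ℝ) < k + 1 := by exact_mod_cast Nat.lt_succ_of_le hk
    have h := tendsto_weilWindowForm_modulated_div_of_riemannHypothesis hRH τ
    have hev := (h.eventually (gt_mem_nhds hlt)).and (eventually_gt_atTop (0 : ℝ))
    obtain ⟨a, ha, ha0⟩ := hev.exists
    refine ⟨a, ha0, ?_⟩
    rw [div_lt_iff₀ (by positivity)] at ha
    linarith
  · rintro ⟨a, ha0, hlt⟩
    have h := two_mul_mul_zetaZeroOrder_le_weilWindowForm hRH ha0 τ
    have h2 : (m : ℝ) < k + 1 := by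
      by_contra hge
      rw [not_lt] at hge
      have : 2 * a * ((k : ℝ) + 1) ≤ 2 * a * (m : ℝ) := mul_le_mul_of_nonneg_left hge (by positivity)
      linarith
    have h3 : m < k + 1 := by exact_mod_cast h2
    omega


/-! ## No certificate below the local spacing (RH corollary of `WindowCertificateNeighbours`) -/

/-- **RH ⟹ NO CERTIFICATE BELOW THE LOCAL SPACING.**  If two distinct heights `γ₁, γ₂ ≠ τ` carrying zeros of
`ζ` (`ord_{s=½+iγ_j} ζ ≥ 1`) satisfy `|γ_j − τ| ≤ 1/a`, then `2a·(ord_{s=½+iτ} ζ + 1) ≤ weilWindowForm a (e^{−iτx}χ_0)`: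
the window of half-length `a` cannot certify the multiplicity at `τ` (its certificate `⌊W/(2a)⌋` is `≥ ord + 1`).
Hence the least certifying window satisfies `a*(τ) ≥ 1/d₂(τ)`, `d₂` the distance from `τ` to the second-nearest
other zero height. -/
theorem two_mul_mul_zetaZeroOrder_add_one_le_of_two_zeros (hRH : RiemannHypothesis) (ha : 0 < a)
    {τ γ₁ γ₂ : ℝ} (h12 : γ₁ ≠ γ₂) (h1 : γ₁ ≠ τ) (h2 : γ₂ ≠ τ) (hd1 : |γ₁ - τ| ≤ a⁻¹) (hd2 : |γ₂ - τ| ≤ a⁻¹)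
    (hz1 : 1 ≤ (riemannZetaZeroOrder (1 / 2 + γ₁ * I)).toNat)
    (hz2 : 1 ≤ (riemannZetaZeroOrder (1 / 2 + γ₂ * I)).toNat) :
    2 * a * (((riemannZetaZeroOrder (1 / 2 + τ * I)).toNat : ℝ) + 1) ≤
      weilWindowForm a (fun x ↦ cexp (I * ((-τ) * x : ℝ)) * chi a 0 x) := by
  have hμ : ∀ g : ℝ → ℂ, IsWeilTest g → tsupport g ⊆ Icc (-a) a →
      Integrable (fun t : ℝ ↦ ‖weilMellin g (1 / 2 + t * I)‖ ^ 2) zetaZeroHeightMeasure ∧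
        weilQuadratic g = ((∫ t, ‖weilMellin g (1 / 2 + t * I)‖ ^ 2 ∂zetaZeroHeightMeasure : ℝ) : ℂ) :=
    fun _ hg _ ↦ WeilBochner.weilQuadratic_eq_integral_of_riemannHypothesis hRH hg
  set B : Set ℝ := Icc (τ - a⁻¹) (τ + a⁻¹) \ {τ} with hB
  have hfin : zetaZeroHeightMeasure B ≠ ⊤ :=
    (lt_of_le_of_lt (measure_mono sdiff_subset)
      (measure_Icc_lt_top_of_integrable
        (Summit.RiemannHypothesis.RiemannHypothesis.Theorems.WeilBochnerMeasure.integrable_inv_one_add_sq ha hμ) _ _)).ne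
  have hmem : ∀ {γ : ℝ}, γ ≠ τ → |γ - τ| ≤ a⁻¹ → γ ∈ B := fun hγ hd ↦
    ⟨⟨by linarith [(abs_le.1 hd).1], by linarith [(abs_le.1 hd).2]⟩, hγ⟩
  have hsub : ({γ₁} ∪ {γ₂} : Set ℝ) ⊆ B :=
    union_subset (singleton_subset_iff.2 (hmem h1 hd1)) (singleton_subset_iff.2 (hmem h2 hd2))
  have hat : ∀ γ : ℝ, zetaZeroHeightMeasure.real {γ} = ((riemannZetaZeroOrder (1 / 2 + γ * I)).toNat : ℝ) :=
    fun γ ↦ by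
      rw [measureReal_def, zetaZeroHeightMeasure_singleton_of_riemannHypothesis hRH, ENNReal.toReal_natCast]
  have hunion : zetaZeroHeightMeasure.real ({γ₁} ∪ {γ₂}) =
      zetaZeroHeightMeasure.real {γ₁} + zetaZeroHeightMeasure.real {γ₂} :=
    measureReal_union (disjoint_singleton.2 h12) (measurableSet_singleton γ₂)
      (measure_ne_top_of_subset (subset_union_left.trans hsub) hfin)
      (measure_ne_top_of_subset (subset_union_right.trans hsub) hfin)
  have hnear : 3 / 2 ≤ zetaZeroHeightMeasure.real B := by
    have hmono := measureReal_mono hsub hfin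
    have e1 : (1 : ℝ) ≤ zetaZeroHeightMeasure.real {γ₁} := by rw [hat]; exact_mod_cast hz1
    have e2 : (1 : ℝ) ≤ zetaZeroHeightMeasure.real {γ₂} := by rw [hat]; exact_mod_cast hz2
    linarith
  have h := two_mul_mul_atom_add_one_le_weilWindowForm ha hμ hnear
  rwa [hat τ] at h

end Summit.Ventures.WeilGRH

end
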